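import Summits.AtomisticToContinuum.Crystallization.Theorems.PalmUnimodularRigidityLayeredLawsSelectHcpMinimiserEnclosure
import Summits.AtomisticToContinuum.Crystallization.Theorems.ReggeStarCoercivityDefectFreeCrystallizesTwelveNeighbours
import Summits.AtomisticToContinuum.Crystallization.Theorems.PalmUnimodularRigidityLayeredLawsSelectHcpChartStarFrame
import Summits.AtomisticToContinuum.Crystallization.Theorems.ReggeStarCoercivityDefectFreeCrystallizesPalmDefs
import Literature.Probability.Process.PointStationaryLaw

/-!
# Small hcp-star defect forces a `1 %`-good root shell (stub G_hcp `stub_goodOfSmallStarDefect` of line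
# `palm-good-law` v27, crux `ReggeStarCoercivity.DefectFreeCrystallizes`, stmt-AtomisticToContinuum-13603)

**Theorem** (`stub_goodOfSmallStarDefect`).  Let `(a₀, h₀)` be a global minimiser of `hcpE` in the box
`[189/200, 199/200] × [77/100, 163/200]`, and let `S ⊆ ℝ³` contain `0` with `SetGood S 0`, no atom in the annulus
`11/10 < ‖y‖ ≤ 5/4`, and hcp-star defect `starDefect a₀ h₀ (count|S) < 1/20000`.  Then for `a = a₀ ∈ [9/10, 1]` the
root shell `T = {y ∈ S : y ≠ 0, ‖y‖ ≤ 5a/4}` is a `Finset` which is `(a/100)`-close (`ShellCloseTo`) to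
`a • hcpKissingPattern`.

**Proof.**
* Enclosure (`tube_minimiserEnclosure`): `|a₀ − 0.97129| ≤ 10⁻⁴`, `|h₀ − 0.79294| ≤ 10⁻⁴`; with
  `0.8164 < √(2/3) < 0.8165` this gives `|a₀ √(2/3) − h₀| ≤ 10⁻³`.
* The twelve neighbours `N = {y ∈ S : 0 < ‖y‖ < 6/5}` have counting measure `12`
  (`TwelveNeighbours.stub_twelveNeighbours`), so `N` is finite with twelve points; the annulus is empty, hence
  `N = rootStar (count|S) = {y ∈ S : y ≠ 0, ‖y‖ ≤ 5a₀/4}` (`6/5 ≤ 5a₀/4 ≤ 5/4`).  Take `T := N`.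
* `ciInf_lt_iff`: some linear isometry `A` has `Σ_v infDist(A (hcpSite a₀ h₀ v), N)² < 1/20000`, so every one of
  the twelve relaxed star points `A (hcpSite a₀ h₀ v)` is within `71/10000` of an atom of `N`
  (`Metric.infDist_lt_iff`).
* The relaxed site differs from the scaled ideal site only in the layer coordinate:
  `dist (a₀ • hcpSite 1 √(2/3) v) (hcpSite a₀ h₀ v) = |k| · |a₀ √(2/3) − h₀| ≤ 10⁻³` (`|k| ≤ 1` on the star).
* `hexIso` carries each point `q` of `hcpKissingPattern` to an ideal star site
  (`exists_label_of_mem_hcpKissingPattern`), so with `A' = A ∘ hexIso` every point `A' (a₀ • q)` of the rotated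
  scaled pattern is within `71/10000 + 10⁻³ ≤ a₀/100` of an atom of `T`.
* Distinct pattern points are `≥ a₀ > 2 · a₀/100` apart, so "nearest atom" is injective on the twelve pattern
  points, hence a bijection onto the twelve atoms (`etaMatched_of_near`).  All `[folklore]`.
-/

noncomputable section

open MeasureTheory
open scoped ENNReal

namespace Summit.AtomisticToContinuum.Crystallization.Theorems.PalmGoodLaw.GoodOfSmallStarDefect

open Literature.MathematicalPhysics.StatisticalMechanics Literature.Geometry.DiscreteGeometry
open Literature.Probability.Process
open Summit.AtomisticToContinuum.Crystallization.Theorems.PalmUnimodularRigidity.LayeredLawsSelectHcp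
open Summit.AtomisticToContinuum.Crystallization.Theorems.LayeredLawsSelectHcp.Negative.HexCubic (hexIso)

/-! ## The relaxed star versus the scaled ideal star -/

/-- The twelve star labels lie in the layers `k ∈ {0, 1, -1}` (by `decide`). [folklore] -/
theorem hcpStarIdx_layer : ∀ v ∈ hcpStarIdx, v.1 = 0 ∨ v.1 = 1 ∨ v.1 = -1 := by decide

/-- **Relaxed versus ideal site.**  The relaxed hcp site `hcpSite a h v` and the scaled ideal site
`a • hcpSite 1 √(2/3) v` differ only in the layer coordinate, by `k (a √(2/3) − h)`. [folklore] -/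
theorem dist_smul_ideal_hcpSite (a h : ℝ) (v : ℤ × ℤ × ℤ) :
    dist (a • hcpSite 1 (Real.sqrt (2 / 3)) v) (hcpSite a h v) =
      |(v.1 : ℝ)| * |a * Real.sqrt (2 / 3) - h| := by
  rw [EuclideanSpace.dist_eq, Fin.sum_univ_three]
  simp only [hcpSite, PiLp.smul_apply, smul_eq_mul, barlowPos_apply_zero, barlowPos_apply_one,
    barlowPos_apply_two, Real.dist_eq]
  conv_rhs => rw [← abs_mul, ← Real.sqrt_sq_eq_abs]
  congr 1
  simp only [sq_abs]
  ring

/-- On the twelve star labels the relaxed site is within `|a √(2/3) − h|` of the scaled ideal site. [folklore] -/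
theorem dist_smul_ideal_hcpSite_le {a h δ : ℝ} (hδ : |a * Real.sqrt (2 / 3) - h| ≤ δ) {v : ℤ × ℤ × ℤ}
    (hv : v ∈ hcpStarIdx) : dist (a • hcpSite 1 (Real.sqrt (2 / 3)) v) (hcpSite a h v) ≤ δ := by
  rw [dist_smul_ideal_hcpSite]
  have hk : |(v.1 : ℝ)| ≤ 1 := by
    rcases hcpStarIdx_layer v hv with h | h | h <;> simp [h]
  calc |(v.1 : ℝ)| * |a * Real.sqrt (2 / 3) - h| ≤ 1 * |a * Real.sqrt (2 / 3) - h| :=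
        mul_le_mul_of_nonneg_right hk (abs_nonneg _)
    _ ≤ δ := by rw [one_mul]; exact hδ

/-! ## A matching from nearest atoms -/

/-- **Nearest-atom matching.**  If `T` and `P` have the same number of points, distinct points of `P` are
`> 2η` apart, and every point of `P` has a point of `T` within `η`, then `T` is `η`-matched to `P`: the
nearest-point map `P → T` is injective (two pattern points sharing an atom would be `≤ 2η` apart), hence a
bijection by counting. [folklore] -/
theorem etaMatched_of_near {η : ℝ} {T P : Finset (EuclideanSpace ℝ (Fin 3))} (hcard : T.card = P.card)
    (hsep : ∀ p ∈ P, ∀ q ∈ P, p ≠ q → 2 * η < dist p q)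
    (hnear : ∀ p ∈ P, ∃ t ∈ T, dist t p ≤ η) : EtaMatched η T P := by
  classical
  have key : ∀ p : ↥P, ∃ t : ↥T, dist (t : EuclideanSpace ℝ (Fin 3)) p ≤ η := fun p => by
    obtain ⟨t, ht, hd⟩ := hnear p p.2
    exact ⟨⟨t, ht⟩, hd⟩
  choose g hg using key
  have hinj : Function.Injective g := by
    intro p q hpq
    by_contra hne
    have hne' : (p : EuclideanSpace ℝ (Fin 3)) ≠ q := fun h => hne (Subtype.ext h)
    have h1 : dist (p : EuclideanSpace ℝ (Fin 3)) (g p) ≤ η := by rw [dist_comm]; exact hg p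
    have h2 : dist ((g p : ↥T) : EuclideanSpace ℝ (Fin 3)) q ≤ η := by rw [hpq]; exact hg q
    have h3 := hsep p p.2 q q.2 hne'
    linarith [dist_triangle (p : EuclideanSpace ℝ (Fin 3)) (g p) q]
  have hbij : Function.Bijective g :=
    (Fintype.bijective_iff_injective_and_card g).2
      ⟨hinj, by rw [Fintype.card_coe, Fintype.card_coe, hcard]⟩
  refine ⟨(Equiv.ofBijective g hbij).symm, fun t => ?_⟩
  have ht : g ((Equiv.ofBijective g hbij).symm t) = t := Equiv.ofBijective_apply_symm_apply g hbij t
  calc dist (t : EuclideanSpace ℝ (Fin 3)) ((Equiv.ofBijective g hbij).symm t)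
      = dist ((g ((Equiv.ofBijective g hbij).symm t) : ↥T) : EuclideanSpace ℝ (Fin 3)) ((Equiv.ofBijective g hbij).symm t) := by
        rw [ht]
    _ ≤ η := hg _

/-! ## The registered stub -/

/-- **G_hcp `stub_goodOfSmallStarDefect` (line `palm-good-law` v27, crux stmt-AtomisticToContinuum-13603): small
hcp-star defect forces a `1 %`-good root shell.**  If `(a₀, h₀)` is a global minimiser of `hcpE` in the box, the
root of `S` is `SetGood`, no atom of `S` lies in the annulus `11/10 < ‖y‖ ≤ 5/4`, and
`starDefect a₀ h₀ (count|S) < 1/20000`, then the root shell in the closed ball of radius `5a/4` is `(a/100)`-close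
to `a • hcpKissingPattern` for `a = a₀ ∈ [9/10, 1]`.  Enclosure `|a₀ − 0.97129|, |h₀ − 0.79294| ≤ 10⁻⁴`
(`tube_minimiserEnclosure`) and `0.8164 < √(2/3) < 0.8165` put the relaxed star within `10⁻³` of the scaled ideal
star; an almost-optimal isometry (`ciInf_lt_iff`) puts each relaxed star point within `71/10000` of one of the
twelve neighbours (`stub_twelveNeighbours`, empty annulus, `Metric.infDist_lt_iff`); `hexIso` identifies the
pattern with the ideal star (`exists_label_of_mem_hcpKissingPattern`); nearest atoms give the matching
(`etaMatched_of_near`, pattern points `≥ a₀` apart), and `71/10000 + 10⁻³ ≤ a₀/100`. [folklore] -/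
theorem stub_goodOfSmallStarDefect :
    ∀ a₀ h₀ : ℝ, 189 / 200 ≤ a₀ → a₀ ≤ 199 / 200 → 77 / 100 ≤ h₀ → h₀ ≤ 163 / 200 →
      (∀ a h : ℝ, 0 < a → 0 < h →
        Summit.AtomisticToContinuum.Crystallization.Theorems.PalmUnimodularRigidity.LayeredLawsSelectHcp.hcpE a₀ h₀ ≤
          Summit.AtomisticToContinuum.Crystallization.Theorems.PalmUnimodularRigidity.LayeredLawsSelectHcp.hcpE a h) →
      ∀ S : Set (EuclideanSpace ℝ (Fin 3)), (0 : EuclideanSpace ℝ (Fin 3)) ∈ S → SetGood S 0 →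
        (Measure.count : Measure (EuclideanSpace ℝ (Fin 3))).restrict S {y : EuclideanSpace ℝ (Fin 3) | 11 / 10 < ‖y‖ ∧ ‖y‖ ≤ 5 / 4} = 0 →
        Summit.AtomisticToContinuum.Crystallization.Theorems.PalmUnimodularRigidity.LayeredLawsSelectHcp.starDefect a₀ h₀
            ((Measure.count : Measure (EuclideanSpace ℝ (Fin 3))).restrict S) < 1 / 20000 →
        ∃ a : ℝ, 9 / 10 ≤ a ∧ a ≤ 1 ∧ ∃ T : Finset (EuclideanSpace ℝ (Fin 3)),
          (↑T : Set (EuclideanSpace ℝ (Fin 3))) =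
            {y : EuclideanSpace ℝ (Fin 3) | (Measure.count : Measure (EuclideanSpace ℝ (Fin 3))).restrict S {y} ≠ 0 ∧ y ≠ 0 ∧ ‖y‖ ≤ 5 / 4 * a} ∧
          ShellCloseTo (a / 100) T (Finset.image (fun v : EuclideanSpace ℝ (Fin 3) => a • v) hcpKissingPattern) := by
  intro a₀ h₀ ha1 ha2 hh1 hh2 hmin S _h0S hgood hann hdef
  -- the minimiser enclosure and the ideal-ratio budget
  obtain ⟨hae, hhe⟩ := tube_minimiserEnclosure a₀ h₀ ha1 ha2 hh1 hh2 hmin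
  rw [abs_le] at hae hhe
  obtain ⟨hae1, hae2⟩ := hae
  obtain ⟨hhe1, hhe2⟩ := hhe
  have ha0 : 0 < a₀ := by linarith
  have hs1 : (8164 / 10000 : ℝ) < Real.sqrt (2 / 3) := by
    rw [Real.lt_sqrt (by norm_num)]; norm_num
  have hs2 : Real.sqrt (2 / 3) < 8165 / 10000 := by
    rw [Real.sqrt_lt' (by norm_num)]; norm_num
  have hδ : |a₀ * Real.sqrt (2 / 3) - h₀| ≤ 1 / 1000 := by
    rw [abs_le]; constructor <;> nlinarith
  -- the twelve neighbours: a finite set of twelve atoms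
  have hmeasB : MeasurableSet {y : EuclideanSpace ℝ (Fin 3) | 0 < ‖y‖ ∧ ‖y‖ < 6 / 5} :=
    (measurableSet_lt measurable_const measurable_norm).inter
      (measurableSet_lt measurable_norm measurable_const)
  have hB := TwelveNeighbours.stub_twelveNeighbours S hgood
  rw [Measure.restrict_apply hmeasB] at hB
  set N : Set (EuclideanSpace ℝ (Fin 3)) := {y : EuclideanSpace ℝ (Fin 3) | 0 < ‖y‖ ∧ ‖y‖ < 6 / 5} ∩ S with hN
  have hNfin : N.Finite := Measure.count_apply_lt_top.1 (by rw [hB]; exact ENNReal.ofNat_lt_top)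
  have hNcard : hNfin.toFinset.card = 12 := by
    have h := hB
    rw [Measure.count_apply_finite N hNfin] at h
    exact_mod_cast h
  -- the annulus is empty
  have hmeasA : MeasurableSet {y : EuclideanSpace ℝ (Fin 3) | 11 / 10 < ‖y‖ ∧ ‖y‖ ≤ 5 / 4} :=
    (measurableSet_lt measurable_const measurable_norm).inter
      (measurableSet_le measurable_norm measurable_const)
  rw [Measure.restrict_apply hmeasA, Measure.count_eq_zero_iff] at hann
  have hnoann : ∀ y ∈ S, 11 / 10 < ‖y‖ → 5 / 4 < ‖y‖ := by
    intro y hy h1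
    by_contra h2
    have hmem : y ∈ {y : EuclideanSpace ℝ (Fin 3) | 11 / 10 < ‖y‖ ∧ ‖y‖ ≤ 5 / 4} ∩ S := ⟨⟨h1, not_lt.1 h2⟩, hy⟩
    rw [hann] at hmem
    exact hmem
  -- the shell `T` and the root star
  set T : Finset (EuclideanSpace ℝ (Fin 3)) := hNfin.toFinset with hT
  have hTcoe : (↑T : Set (EuclideanSpace ℝ (Fin 3))) = N := hNfin.coe_toFinset
  have hroot : rootStar ((Measure.count : Measure (EuclideanSpace ℝ (Fin 3))).restrict S) = N := by
    ext y
    simp only [rootStar, Set.mem_setOf_eq, hN, Set.mem_inter_iff]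
    rw [count_restrict_singleton_ne_zero_iff]
    constructor
    · rintro ⟨hy, h0, h1⟩
      exact ⟨⟨h0, by linarith⟩, hy⟩
    · rintro ⟨⟨h0, h1⟩, hy⟩
      refine ⟨hy, h0, ?_⟩
      by_contra h
      have := hnoann y hy (not_le.1 h)
      linarith
  have hNne : N.Nonempty := by
    rw [← hTcoe, Finset.coe_nonempty, ← Finset.card_pos, hNcard]
    norm_num
  -- an almost-optimal isometry: every relaxed star point is near an atom
  have hbdd : BddBelow (Set.range fun A : EuclideanSpace ℝ (Fin 3) ≃ₗᵢ[ℝ] EuclideanSpace ℝ (Fin 3) =>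
      ∑ v ∈ hcpStarIdx, (Metric.infDist (A (hcpSite a₀ h₀ v))
        (rootStar ((Measure.count : Measure (EuclideanSpace ℝ (Fin 3))).restrict S))) ^ 2) :=
    ⟨0, by rintro _ ⟨A, rfl⟩; exact Finset.sum_nonneg fun _ _ => sq_nonneg _⟩
  obtain ⟨A, hA⟩ := (ciInf_lt_iff hbdd).1 hdef
  rw [hroot] at hA
  have hnearv : ∀ v ∈ hcpStarIdx, ∃ y ∈ N, dist (A (hcpSite a₀ h₀ v)) y < 71 / 10000 := by
    intro v hv
    have hle : (Metric.infDist (A (hcpSite a₀ h₀ v)) N) ^ 2 ≤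
        ∑ w ∈ hcpStarIdx, (Metric.infDist (A (hcpSite a₀ h₀ w)) N) ^ 2 :=
      Finset.single_le_sum (fun w _ => sq_nonneg (Metric.infDist (A (hcpSite a₀ h₀ w)) N)) hv
    have hlt : Metric.infDist (A (hcpSite a₀ h₀ v)) N < 71 / 10000 := by
      by_contra hge
      rw [not_lt] at hge
      have h2 : (71 / 10000 : ℝ) ^ 2 ≤ (Metric.infDist (A (hcpSite a₀ h₀ v)) N) ^ 2 :=
        pow_le_pow_left₀ (by norm_num) hge 2
      norm_num at h2
      linarith
    exact (Metric.infDist_lt_iff hNne).1 hlt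
  -- the frame of the conclusion and the rotated scaled pattern
  set A' : EuclideanSpace ℝ (Fin 3) →ₗᵢ[ℝ] EuclideanSpace ℝ (Fin 3) := A.toLinearIsometry.comp hexIso with hA'
  set P' : Finset (EuclideanSpace ℝ (Fin 3)) := (hcpKissingPattern.image fun v : EuclideanSpace ℝ (Fin 3) => a₀ • v).image A' with hP'
  have hP'card : P'.card = 12 := by
    rw [hP', Finset.card_image_of_injective _ A'.injective,
      Finset.card_image_of_injective _ (smul_right_injective (EuclideanSpace ℝ (Fin 3)) ha0.ne'), card_hcpKissingPattern]
  have hP'sep : ∀ p ∈ P', ∀ q ∈ P', p ≠ q → 2 * (a₀ / 100) < dist p q := by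
    intro p hp q hq hpq
    obtain ⟨p₁, hp₁, rfl⟩ := Finset.mem_image.1 hp
    obtain ⟨p₂, hp₂, rfl⟩ := Finset.mem_image.1 hp₁
    obtain ⟨q₁, hq₁, rfl⟩ := Finset.mem_image.1 hq
    obtain ⟨q₂, hq₂, rfl⟩ := Finset.mem_image.1 hq₁
    have hne : p₂ ≠ q₂ := fun h => hpq (by rw [h])
    have h1 := one_le_dist_of_mem_hcpKissingPattern hp₂ hq₂ hne
    rw [LinearIsometry.dist_map, dist_smul₀, Real.norm_of_nonneg ha0.le]
    nlinarith
  have hP'near : ∀ p ∈ P', ∃ t ∈ T, dist t p ≤ a₀ / 100 := by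
    intro p hp
    obtain ⟨p₁, hp₁, rfl⟩ := Finset.mem_image.1 hp
    obtain ⟨q, hq, rfl⟩ := Finset.mem_image.1 hp₁
    obtain ⟨v, hv, hqv⟩ := exists_label_of_mem_hcpKissingPattern hq
    obtain ⟨y, hyN, hyd⟩ := hnearv v hv
    refine ⟨y, by rw [← Finset.mem_coe, hTcoe]; exact hyN, ?_⟩
    have hAq : A' (a₀ • q) = A (a₀ • hcpSite 1 (Real.sqrt (2 / 3)) v) := by
      simp only [hA', LinearIsometry.coe_comp, Function.comp_apply, LinearIsometry.map_smul, hqv,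
        LinearIsometryEquiv.coe_toLinearIsometry, LinearIsometryEquiv.map_smul]
    rw [hAq]
    have h1 : dist (A (a₀ • hcpSite 1 (Real.sqrt (2 / 3)) v)) (A (hcpSite a₀ h₀ v)) ≤ 1 / 1000 := by
      rw [LinearIsometryEquiv.dist_map]
      exact dist_smul_ideal_hcpSite_le hδ hv
    rw [dist_comm] at hyd
    have htri := dist_triangle y (A (hcpSite a₀ h₀ v)) (A (a₀ • hcpSite 1 (Real.sqrt (2 / 3)) v))
    rw [dist_comm (A (hcpSite a₀ h₀ v)) (A (a₀ • hcpSite 1 (Real.sqrt (2 / 3)) v))] at htri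
    linarith
  -- conclusion
  refine ⟨a₀, by linarith, by linarith, T, ?_,
    A', etaMatched_of_near (by rw [hNcard, hP'card]) hP'sep hP'near⟩
  rw [hTcoe]
  ext y
  simp only [hN, Set.mem_inter_iff, Set.mem_setOf_eq]
  rw [count_restrict_singleton_ne_zero_iff]
  constructor
  · rintro ⟨⟨h0, h1⟩, hy⟩
    exact ⟨hy, norm_pos_iff.1 h0, by linarith⟩
  · rintro ⟨hy, hy0, hle⟩
    refine ⟨⟨norm_pos_iff.2 hy0, ?_⟩, hy⟩
    by_contra hge
    rw [not_lt] at hge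
    have h2 := hnoann y hy (by linarith)
    linarith

end Summit.AtomisticToContinuum.Crystallization.Theorems.PalmGoodLaw.GoodOfSmallStarDefect

end
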